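import Mathlib
import Literature.Algebra.Polynomial.SturmTheorem
import Literature.Computability.AlgebraicComplexity.BD17DescartesRuleRootCounting

/-!
# Two-sided Descartes–Laguerre rule on an interval, part 1: Rolle count, tail elements, sign variations

HONEST FRAMING.  Helper file toward the lifting crux `WeakLifting` (stmt-ValiantsHypothesis-19561; aside `Lifting`
stmt-ValiantsHypothesis-19772, registered stub `stub_liftThin`) of route `KPlusLogSqLaw` (cell `pub-symmetroid`, seat
val-sym-lift-p1 g8, 2026-08-27).  Elementary real analysis about ONE real function on an interval `(a, b)`, `0 < a < b`; nothing
here asserts `WeakLifting`, `TropicalB`, Conjecture B, `MatrixDescartes` (stmt-ValiantsHypothesis-18050) or anything about VP ≠ VNP.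

CONTEXT (parts 1–4, files `…LaguerreWindowCalculus`, `…LaguerreWindowEuler`, `…LaguerreWindowSteps`, `…LaguerreWindow`).
The analytic core of the TWO-POINT form of Laguerre's extension of Descartes' rule of signs (one-point form:
[VanMieghem2010, art. 317, Thm 88] = Laguerre: the zeros of `f` beyond `ξ` number at most the sign changes of the partial sums
of `f(ξ)`, proved by expanding `f(z)/(z − ξ)`).  Dividing instead by `(x − a)(b − x)` produces, on `(a, b)`,
`F(x) = σ_L · L(x) + Σ_k g_k x^k + σ_H · H(x)` with `L` a non-negative combination of LOW TAIL elements `x^m (x − a)^n`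
(`n ≤ 0`, «virtual exponent» `m + n ≤ e`), `H` a non-negative combination of HIGH TAIL elements `x^m (b − x)^n` (`n ≤ 0`,
`m ≥ N`), window exponents `e < k < N`; part 4 proves `#zeros ≤ Var(σ_L·L, g_1, …, g_r, σ_H·H)` by Descartes' induction
with the Euler operator `θ − k = x·d/dx − k` (it maps the low class to minus itself for `k > e`, the high class to itself for
`k < N`, kills `x^k`, flips the signs below).  No power series: both tail classes are finite-dimensional and `θ − k`-stable.

THIS FILE: the Rolle count (`exists_finset_deriv_zeros`, `exists_finset_zeros_euler`), the Euler-form derivatives and the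
positivity of the tail elements and of non-negative combinations of them (data = lists of triples `(β, m, n)`, evaluated by
explicit sums — no `def`), and a small API for the Literature's `signVar` on real lists (zeros dropped): recursion, congruence
under entrywise sign-equivalence, singleton.
[folklore] (Laguerre's method; quantitative one-variable Descartes theory).
-/

set_option linter.dupNamespace false
set_option autoImplicit false

namespace Summit.ValiantsHypothesis.ValiantsHypothesis.Theorems.KPlusLogSqLaw.LocalDescartes

open Set Finset
open scoped BigOperators
open Literature.Algebra.Polynomial (signVar signVarAux)
open Literature.Computability.AlgebraicComplexity.BD17 (signVar_cons_cons_of_ne_zero)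

/-! ## Rolle: zeros of `F` versus zeros of `(θ − k)F` -/

/-- **Rolle count.** If `g` has derivative `g'` on `(a,b)`, every finite set of zeros of `g` in `(a,b)` yields a finite set of
zeros of `g'` in `(a,b)` with at most one element less. [folklore] -/
theorem exists_finset_deriv_zeros {a b : ℝ} {g g' : ℝ → ℝ} (hg : ∀ x ∈ Ioo a b, HasDerivAt g (g' x) x)
    (Z : Finset ℝ) (hZ : ∀ z ∈ Z, z ∈ Ioo a b ∧ g z = 0) :
    ∃ Z' : Finset ℝ, Z.card ≤ Z'.card + 1 ∧ ∀ c ∈ Z', c ∈ Ioo a b ∧ g' c = 0 := by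
  classical
  -- strengthened invariant: every point of `Z'` lies below some point of `Z`
  suffices h : ∀ S : Finset ℝ, (∀ z ∈ S, z ∈ Ioo a b ∧ g z = 0) →
      ∃ Z' : Finset ℝ, S.card ≤ Z'.card + 1 ∧ ∀ c ∈ Z', (c ∈ Ioo a b ∧ g' c = 0) ∧ ∃ z ∈ S, c < z by
    obtain ⟨Z', h1, h2⟩ := h Z hZ
    exact ⟨Z', h1, fun c hc => (h2 c hc).1⟩
  intro S
  induction S using Finset.induction_on_max with
  | empty => intro _; exact ⟨∅, by simp, by simp⟩
  | insert x₀ s hlt ih =>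
    intro hS
    have hx₀ : x₀ ∈ Ioo a b ∧ g x₀ = 0 := hS x₀ (Finset.mem_insert_self _ _)
    have hs : ∀ z ∈ s, z ∈ Ioo a b ∧ g z = 0 := fun z hz => hS z (Finset.mem_insert_of_mem hz)
    obtain ⟨Z', hcard, hZ'⟩ := ih hs
    have hx₀s : x₀ ∉ s := fun h => lt_irrefl _ (hlt x₀ h)
    rcases s.eq_empty_or_nonempty with hse | hne
    · subst hse
      refine ⟨∅, by simp, by simp⟩
    · set z₁ := s.max' hne with hz₁
      have hz₁s : z₁ ∈ s := Finset.max'_mem s hne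
      have hz₁x : z₁ < x₀ := hlt z₁ hz₁s
      have hz₁I := (hs z₁ hz₁s).1
      -- Rolle on `[z₁, x₀]`
      have hsub : Icc z₁ x₀ ⊆ Ioo a b := fun y hy => ⟨lt_of_lt_of_le hz₁I.1 hy.1, lt_of_le_of_lt hy.2 hx₀.1.2⟩
      have hcont : ContinuousOn g (Icc z₁ x₀) := fun y hy =>
        (hg y (hsub hy)).continuousAt.continuousWithinAt
      obtain ⟨c, hc, hgc⟩ := exists_hasDerivAt_eq_zero hz₁x hcont (by rw [(hs z₁ hz₁s).2, hx₀.2])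
        (fun y hy => hg y (hsub (Ioo_subset_Icc_self hy)))
      have hcZ' : c ∉ Z' := by
        intro hcm
        obtain ⟨-, z, hz, hcz⟩ := hZ' c hcm
        have : z ≤ z₁ := Finset.le_max' s z hz
        linarith [hc.1]
      refine ⟨insert c Z', ?_, ?_⟩
      · rw [Finset.card_insert_of_notMem hx₀s, Finset.card_insert_of_notMem hcZ']
        omega
      · intro c' hc'
        rcases Finset.mem_insert.mp hc' with rfl | hc''
        · exact ⟨⟨hsub (Ioo_subset_Icc_self hc), hgc⟩, x₀, Finset.mem_insert_self _ _, hc.2⟩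
        · obtain ⟨h1, z, hz, hcz⟩ := hZ' c' hc''
          exact ⟨h1, z, Finset.mem_insert_of_mem hz, hcz⟩

/-- **Zeros of `F` vs zeros of `(θ − k)F`.** If `x ↦ x^{−k} F(x)` has derivative `x^{−k−1} G(x)` on `(a,b)` with `a > 0`, then
any finite set of zeros of `F` in `(a,b)` is at most one larger than some finite set of zeros of `G` there. [folklore] -/
theorem exists_finset_zeros_euler {a b : ℝ} (ha : 0 < a) {F G : ℝ → ℝ} (k : ℤ)
    (hFG : ∀ x ∈ Ioo a b, HasDerivAt (fun y => y ^ (-k) * F y) (x ^ (-k - 1) * G x) x)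
    (Z : Finset ℝ) (hZ : ∀ z ∈ Z, z ∈ Ioo a b ∧ F z = 0) :
    ∃ Z' : Finset ℝ, Z.card ≤ Z'.card + 1 ∧ ∀ c ∈ Z', c ∈ Ioo a b ∧ G c = 0 := by
  obtain ⟨Z', h1, h2⟩ := exists_finset_deriv_zeros hFG Z (fun z hz => ⟨(hZ z hz).1, by rw [(hZ z hz).2, mul_zero]⟩)
  refine ⟨Z', h1, fun c hc => ⟨(h2 c hc).1, ?_⟩⟩
  have hc0 : 0 < c := ha.trans (h2 c hc).1.1
  have hne : c ^ (-k - 1) ≠ 0 := zpow_ne_zero _ hc0.ne'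
  exact (mul_eq_zero.mp (h2 c hc).2).resolve_left hne

/-! ## The two tail classes: positivity and the Euler operator -/

/-- derivative of a low-tail element `x^m (x − a)^n`, in Euler form: `x · d/dx = (m+n)·x^m(x−a)^n + n a·x^m(x−a)^{n−1}`. [folklore] -/
theorem hasDerivAt_lowTerm (a : ℝ) (m n : ℤ) {x : ℝ} (hx : a < x) (h0 : 0 < x) :
    HasDerivAt (fun y : ℝ => y ^ m * (y - a) ^ n)
      ((((m + n : ℤ) : ℝ) * (x ^ m * (x - a) ^ n) + (n : ℝ) * a * (x ^ m * (x - a) ^ (n - 1))) / x) x := by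
  have hxa : x - a ≠ 0 := sub_ne_zero.mpr (ne_of_gt hx)
  have h1 : HasDerivAt (fun y : ℝ => y ^ m) ((m : ℝ) * x ^ (m - 1)) x := hasDerivAt_zpow m x (Or.inl h0.ne')
  have h2 : HasDerivAt (fun y : ℝ => (y - a) ^ n) ((n : ℝ) * (x - a) ^ (n - 1) * 1) x := by
    have := HasDerivAt.comp x (h₂ := fun z : ℝ => z ^ n) (hasDerivAt_zpow n (x - a) (Or.inl hxa))
      ((hasDerivAt_id' x).sub_const a)
    simpa only [Function.comp_def] using this
  have h : HasDerivAt (fun y : ℝ => y ^ m * (y - a) ^ n)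
      ((m : ℝ) * x ^ (m - 1) * (x - a) ^ n + x ^ m * ((n : ℝ) * (x - a) ^ (n - 1) * 1)) x := h1.fun_mul h2
  refine h.congr_deriv ?_
  have ex1 : x ^ m = x ^ (m - 1) * x := by
    rw [← zpow_add_one₀ h0.ne', sub_add_cancel]
  have ex2 : (x - a) ^ n = (x - a) ^ (n - 1) * (x - a) := by
    rw [← zpow_add_one₀ hxa, sub_add_cancel]
  rw [eq_div_iff h0.ne', ex1, ex2]
  push_cast
  ring

/-- derivative of a high-tail element `x^m (b − x)^n`, in Euler form: `x · d/dx = m·x^m(b−x)^n + (−n)·x^{m+1}(b−x)^{n−1}`. [folklore] -/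
theorem hasDerivAt_highTerm (b : ℝ) (m n : ℤ) {x : ℝ} (hx : x < b) (h0 : 0 < x) :
    HasDerivAt (fun y : ℝ => y ^ m * (b - y) ^ n)
      ((((m : ℤ) : ℝ) * (x ^ m * (b - x) ^ n) + (-(n : ℝ)) * (x ^ (m + 1) * (b - x) ^ (n - 1))) / x) x := by
  have hxb : b - x ≠ 0 := sub_ne_zero.mpr (ne_of_gt hx)
  have h1 : HasDerivAt (fun y : ℝ => y ^ m) ((m : ℝ) * x ^ (m - 1)) x := hasDerivAt_zpow m x (Or.inl h0.ne')
  have h2 : HasDerivAt (fun y : ℝ => (b - y) ^ n) ((n : ℝ) * (b - x) ^ (n - 1) * (0 - 1)) x :=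
    (hasDerivAt_zpow n (b - x) (Or.inl hxb)).comp x ((hasDerivAt_const x b).sub (hasDerivAt_id' x))
  have h : HasDerivAt (fun y : ℝ => y ^ m * (b - y) ^ n)
      ((m : ℝ) * x ^ (m - 1) * (b - x) ^ n + x ^ m * ((n : ℝ) * (b - x) ^ (n - 1) * (0 - 1))) x := h1.fun_mul h2
  refine h.congr_deriv ?_
  have ex1 : x ^ m = x ^ (m - 1) * x := by
    rw [← zpow_add_one₀ h0.ne', sub_add_cancel]
  have ex3 : x ^ (m + 1) = x ^ (m - 1) * x * x := by
    rw [← ex1, zpow_add_one₀ h0.ne']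
  have ex2 : (b - x) ^ n = (b - x) ^ (n - 1) * (b - x) := by
    rw [← zpow_add_one₀ hxb, sub_add_cancel]
  rw [eq_div_iff h0.ne', ex3, ex2, ex1]
  ring


/-! ## Sign variations of real lists (the Literature's `signVar`, zeros dropped) -/

/-- a leading zero is dropped. [folklore] -/
theorem signVar_zero_cons (l : List ℝ) : signVar (0 :: l) = signVar l := by
  simp [signVar]

/-- a zero in second position is dropped. [folklore] -/
theorem signVar_cons_zero_cons (y : ℝ) (l : List ℝ) : signVar (y :: 0 :: l) = signVar (y :: l) := by
  unfold signVar
  by_cases hy : y = 0 <;> simp [hy]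

/-- `signVarAux` agrees on entrywise sign-equivalent lists of non-zero reals. [folklore] -/
theorem signVarAux_congr : ∀ (l₁ l₂ : List ℝ),
    List.Forall₂ (fun u v => (0 < u ↔ 0 < v) ∧ (u < 0 ↔ v < 0)) l₁ l₂ →
    (∀ u ∈ l₁, u ≠ 0) → signVarAux l₁ = signVarAux l₂
  | [], _, h, _ => by cases h; rfl
  | [u], _, h, _ => by
    cases h with
    | cons huv htail => cases htail; simp [signVarAux]
  | u :: u' :: l, _, h, hne => by
    cases h with
    | cons huv htail =>
      cases htail with
      | cons hu'v' htail' =>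
        rename_i v v' l₂
        have ih := signVarAux_congr (u' :: l) (v' :: l₂) (List.Forall₂.cons hu'v' htail')
          (fun w hw => hne w (List.mem_cons_of_mem _ hw))
        simp only [signVarAux]
        rw [ih]
        have hu : u ≠ 0 := hne u (by simp)
        have hu' : u' ≠ 0 := hne u' (by simp)
        congr 1
        have key : (u * u' < 0 ↔ v * v' < 0) := by
          rcases lt_or_gt_of_ne hu with h1 | h1 <;> rcases lt_or_gt_of_ne hu' with h2 | h2
          · have := huv.2.mp h1; have := hu'v'.2.mp h2
            constructor <;> intro <;> nlinarith
          · have := huv.2.mp h1; have := hu'v'.1.mp h2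
            constructor <;> intro <;> nlinarith
          · have := huv.1.mp h1; have := hu'v'.2.mp h2
            constructor <;> intro <;> nlinarith
          · have := huv.1.mp h1; have := hu'v'.1.mp h2
            constructor <;> intro <;> nlinarith
        simp [key]

/-- zeros sit at the same places in entrywise sign-equivalent lists, so filtering them keeps the relation. [folklore] -/
theorem filter_ne_zero_forall₂ : ∀ (l₁ l₂ : List ℝ),
    List.Forall₂ (fun u v => (0 < u ↔ 0 < v) ∧ (u < 0 ↔ v < 0)) l₁ l₂ →
    List.Forall₂ (fun u v => (0 < u ↔ 0 < v) ∧ (u < 0 ↔ v < 0))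
      (l₁.filter (fun x => x ≠ 0)) (l₂.filter (fun x => x ≠ 0))
  | [], [], _ => by simp
  | [], _ :: _, h => by cases h
  | _ :: _, [], h => by cases h
  | u :: l₁, v :: l₂, h => by
    have huv : (0 < u ↔ 0 < v) ∧ (u < 0 ↔ v < 0) := by cases h with | cons h1 _ => exact h1
    have ht : List.Forall₂ (fun u v => (0 < u ↔ 0 < v) ∧ (u < 0 ↔ v < 0)) l₁ l₂ := by
      cases h with | cons _ h2 => exact h2
    have ih := filter_ne_zero_forall₂ l₁ l₂ ht
    by_cases hu : u = 0
    · have hv : v = 0 := by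
        by_contra hv
        rcases lt_or_gt_of_ne hv with hv' | hv'
        · have := huv.2.mpr hv'; rw [hu] at this; exact lt_irrefl _ this
        · have := huv.1.mpr hv'; rw [hu] at this; exact lt_irrefl _ this
      subst hu; subst hv
      simpa using ih
    · have hv : v ≠ 0 := by
        intro hv
        rcases lt_or_gt_of_ne hu with hu' | hu'
        · have := huv.2.mp hu'; rw [hv] at this; exact lt_irrefl _ this
        · have := huv.1.mp hu'; rw [hv] at this; exact lt_irrefl _ this
      simp only [List.filter_cons, ne_eq, hu, not_false_eq_true, decide_true, hv]
      exact List.Forall₂.cons huv ih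

/-- **congruence:** entrywise sign-equivalent lists have the same number of sign variations. [folklore] -/
theorem signVar_congr {l₁ l₂ : List ℝ}
    (h : List.Forall₂ (fun u v => (0 < u ↔ 0 < v) ∧ (u < 0 ↔ v < 0)) l₁ l₂) : signVar l₁ = signVar l₂ := by
  unfold signVar
  apply signVarAux_congr _ _ (filter_ne_zero_forall₂ l₁ l₂ h)
  intro u hu
  have := (List.mem_filter.mp hu).2
  simpa using this

/-- `Var` of a singleton is `0`. [folklore] -/
theorem signVar_single (y : ℝ) : signVar [y] = 0 := by
  unfold signVar
  by_cases hy : y = 0 <;> simp [hy, signVarAux]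

/-! ## Evaluation of tail data: positivity -/

/-- every low-tail element is positive on `(a, b)`. [folklore] -/
theorem lowTerm_pos (a : ℝ) (m n : ℤ) {x : ℝ} (hx : a < x) (h0 : 0 < x) : 0 < x ^ m * (x - a) ^ n :=
  mul_pos (zpow_pos h0 m) (zpow_pos (sub_pos.mpr hx) n)

/-- every high-tail element is positive on `(a, b)`. [folklore] -/
theorem highTerm_pos (b : ℝ) (m n : ℤ) {x : ℝ} (hx : x < b) (h0 : 0 < x) : 0 < x ^ m * (b - x) ^ n :=
  mul_pos (zpow_pos h0 m) (zpow_pos (sub_pos.mpr hx) n)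

/-- a non-negative combination of positive functions is either identically zero (no positive coefficient) or
positive (some positive coefficient): low tails. [folklore] -/
theorem lowEval_pos_or_zero (a : ℝ) : ∀ (L : List (ℝ × ℤ × ℤ)), (∀ t ∈ L, 0 ≤ t.1) →
    ((∃ t ∈ L, 0 < t.1) → ∀ x, a < x → 0 < x →
      0 < (L.map (fun t : ℝ × ℤ × ℤ => t.1 * (x ^ t.2.1 * (x - a) ^ t.2.2))).sum) ∧
    ((¬ ∃ t ∈ L, 0 < t.1) → ∀ x : ℝ, (L.map (fun t : ℝ × ℤ × ℤ => t.1 * (x ^ t.2.1 * (x - a) ^ t.2.2))).sum = 0)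
  | [], _ => by simp
  | t :: L, hL => by
    have ht : 0 ≤ t.1 := hL t (by simp)
    have hL' : ∀ t' ∈ L, 0 ≤ t'.1 := fun t' ht' => hL t' (List.mem_cons_of_mem _ ht')
    obtain ⟨ih1, ih2⟩ := lowEval_pos_or_zero a L hL'
    have nonneg : ∀ x, a < x → 0 < x →
        0 ≤ (L.map (fun t : ℝ × ℤ × ℤ => t.1 * (x ^ t.2.1 * (x - a) ^ t.2.2))).sum := by
      intro x hx h0
      by_cases hex : ∃ t' ∈ L, 0 < t'.1
      · exact (ih1 hex x hx h0).le
      · exact (ih2 hex x).ge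
    refine ⟨?_, ?_⟩
    · rintro ⟨t', ht'mem, ht'pos⟩ x hx h0
      simp only [List.map_cons, List.sum_cons]
      rcases List.mem_cons.mp ht'mem with rfl | hmem
      · exact add_pos_of_pos_of_nonneg (mul_pos ht'pos (lowTerm_pos a _ _ hx h0)) (nonneg x hx h0)
      · exact add_pos_of_nonneg_of_pos (mul_nonneg ht (lowTerm_pos a _ _ hx h0).le) (ih1 ⟨t', hmem, ht'pos⟩ x hx h0)
    · intro hno x
      have ht0 : t.1 = 0 := le_antisymm (not_lt.mp fun h => hno ⟨t, by simp, h⟩) ht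
      have hno' : ¬ ∃ t' ∈ L, 0 < t'.1 := fun ⟨t', h1, h2⟩ => hno ⟨t', List.mem_cons_of_mem _ h1, h2⟩
      simp only [List.map_cons, List.sum_cons, ht0, zero_mul, zero_add]
      exact ih2 hno' x

/-- the same dichotomy for high tails. [folklore] -/
theorem highEval_pos_or_zero (b : ℝ) : ∀ (H : List (ℝ × ℤ × ℤ)), (∀ t ∈ H, 0 ≤ t.1) →
    ((∃ t ∈ H, 0 < t.1) → ∀ x, x < b → 0 < x →
      0 < (H.map (fun t : ℝ × ℤ × ℤ => t.1 * (x ^ t.2.1 * (b - x) ^ t.2.2))).sum) ∧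
    ((¬ ∃ t ∈ H, 0 < t.1) → ∀ x : ℝ, (H.map (fun t : ℝ × ℤ × ℤ => t.1 * (x ^ t.2.1 * (b - x) ^ t.2.2))).sum = 0)
  | [], _ => by simp
  | t :: H, hH => by
    have ht : 0 ≤ t.1 := hH t (by simp)
    have hH' : ∀ t' ∈ H, 0 ≤ t'.1 := fun t' ht' => hH t' (List.mem_cons_of_mem _ ht')
    obtain ⟨ih1, ih2⟩ := highEval_pos_or_zero b H hH'
    have nonneg : ∀ x, x < b → 0 < x →
        0 ≤ (H.map (fun t : ℝ × ℤ × ℤ => t.1 * (x ^ t.2.1 * (b - x) ^ t.2.2))).sum := by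
      intro x hx h0
      by_cases hex : ∃ t' ∈ H, 0 < t'.1
      · exact (ih1 hex x hx h0).le
      · exact (ih2 hex x).ge
    refine ⟨?_, ?_⟩
    · rintro ⟨t', ht'mem, ht'pos⟩ x hx h0
      simp only [List.map_cons, List.sum_cons]
      rcases List.mem_cons.mp ht'mem with rfl | hmem
      · exact add_pos_of_pos_of_nonneg (mul_pos ht'pos (highTerm_pos b _ _ hx h0)) (nonneg x hx h0)
      · exact add_pos_of_nonneg_of_pos (mul_nonneg ht (highTerm_pos b _ _ hx h0).le) (ih1 ⟨t', hmem, ht'pos⟩ x hx h0)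
    · intro hno x
      have ht0 : t.1 = 0 := le_antisymm (not_lt.mp fun h => hno ⟨t, by simp, h⟩) ht
      have hno' : ¬ ∃ t' ∈ H, 0 < t'.1 := fun ⟨t', h1, h2⟩ => hno ⟨t', List.mem_cons_of_mem _ h1, h2⟩
      simp only [List.map_cons, List.sum_cons, ht0, zero_mul, zero_add]
      exact ih2 hno' x

/-! ## Sign relations used in the induction -/

/-- `u = t·v` with `t > 0` forces equal signs. [folklore] -/
theorem signRel_of_posMul {u v t : ℝ} (ht : 0 < t) (h : u = t * v) : (0 < u ↔ 0 < v) ∧ (u < 0 ↔ v < 0) := by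
  subst h
  constructor
  · constructor
    · intro hu; by_contra hv; push Not at hv; nlinarith
    · intro hv; positivity
  · constructor
    · intro hu; by_contra hv; push Not at hv; nlinarith
    · intro hv; nlinarith

/-- the window coefficients keep their signs under `(θ − k)` when all exponents exceed `k`. [folklore] -/
theorem forall₂_window_rescale (k : ℤ) : ∀ (W₀ : List (ℤ × ℝ)), (∀ q ∈ W₀, k < q.1) →
    List.Forall₂ (fun u v => (0 < u ↔ 0 < v) ∧ (u < 0 ↔ v < 0)) (W₀.map Prod.snd)
      ((W₀.map (fun q : ℤ × ℝ => (q.1, ((q.1 : ℝ) - k) * q.2))).map Prod.snd)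
  | [], _ => by simp
  | q :: W₀, h => by
    simp only [List.map_cons]
    refine List.Forall₂.cons ?_ (forall₂_window_rescale k W₀ (fun q' hq' => h q' (List.mem_cons_of_mem _ hq')))
    have hq : (k : ℝ) < (q.1 : ℝ) := by exact_mod_cast h q (by simp)
    have hpos : 0 < (q.1 : ℝ) - k := by linarith
    have e1 : q.2 = ((q.1 : ℝ) - k)⁻¹ * (((q.1 : ℝ) - k) * q.2) := by
      rw [← mul_assoc, inv_mul_cancel₀ hpos.ne', one_mul]
    exact signRel_of_posMul (inv_pos.mpr hpos) e1

end Summit.ValiantsHypothesis.ValiantsHypothesis.Theorems.KPlusLogSqLaw.LocalDescartes
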